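import Mathlib
import HarnessLib
import HarnessLib.Audit
import Summits.Parity.Statement
import Literature.NumberTheory.Sieve.IwaniecAlmostPrimes
import Literature.NumberTheory.Sieve.BuchstabFunction

/-!
Route: BuchstabTransport

CLOSED (retired) 2026-08-15T13:49:20Z by operator:999:1257524 — reason: not-a-thesis: assembly does not conclude the sub-problem Statement — note: D-0027 §2.1 audit (human 2026-08-15: routes that do not decide the summit are removed): the assembly concludes `Literature.NumberTheory.Sieve.HardyLittlewoodConjE`, not the sub-problem statement; a NEW conforming route may be opened from the same idea (generated `closes : … → _root_.BatemanHorn`).. The file is kept as the record of this route; refuted decls are indexed as negative knowledge (`ledger negatives`).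

# Route BuchstabTransport — HL-E as the u = 2 boundary value of Buchstab's law for n²+1 — constant
transported from the fundamental lemma, boundary layer = balanced semiprimes

First open instance f = X²+1 (Hardy–Littlewood E ⊂ BatemanHorn). Write Φ(x,u) := #{1 ≤ n ≤ x : every
prime p | n²+1 has p ≥ x^{2/u}}
(= `Iwaniec1978.siftedCount x 1 (x^(2/u))`, the sifting function of 𝒜 = {n²+1} at z = x^{2/u}; u =
log(size of values)/log z) and ω for
Buchstab's function (`buchstabOmega`). The card's one-parameter family B_f(u) ("Buchstab's law along
f") is Φ(x,u) ~ (𝔖/2)·u ω(u)·x/log x: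
for u ≤ 2 it IS HL-E (rough values are prime), for u → ∞ it is the fundamental lemma (theorem). The
route does NOT ask for any rung
u ≤ 2 and does NOT ask for the constant. It suffices to show X = X1 ∧ X2: (X1 = RoughValueLaw) for
SOME constant A and every depth
u > 2, Φ(x,u)·log x/x → A·u ω(u) (Buchstab SHAPE beyond the prime threshold, constant free); (X2 =
BalancedSemiprimeLayer) the boundary
layer at u = 2⁺ is thin: the z-rough but composite values with z = x^{1−δ} — necessarily n²+1 = p₁p₂
with x^{1−δ} ≤ p₁ ≤ p₂ ≤ x^{1+δ},
"balanced semiprimes" — are ≤ ε x/log x once δ ≤ δ(ε). Then the constant is FORCED: the tree's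
fundamental lemma and Mertens' theorem
for ρ (`Iwaniec1978.tendsto_densityProd_mul_log`: V(z) log z → 𝔖e^{−γ}) pin A·ω(u) → (𝔖/2)e^{−γ} as
u → ∞ (support SieveCalibration),
ω(u) → e^{−γ} (support BuchstabLimit) gives A = 𝔖/2, and letting u ↓ 2 (uω(u) = 1 + log(u−1) → 1)
squeezes π_{n²+1}(x) ~ (𝔖/2) x/log x,
i.e. `HardyLittlewoodConjE`. Realises cards fixed-f-irregularity-parity-gated (spine: the family
B_f(U) "from FL (U = ∞) to BH (U ≤ 2)", its
window-vs-signal lemma N1 = support WindowVsSignal) and rough-values-buchstab-parity (its RL(f,u)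
restricted to u > 2, unsigned part).
Lean: `(∃ A : ℝ, ∀ u : ℝ, 2 < u → Filter.Tendsto (fun x : ℝ =>
(Literature.NumberTheory.Sieve.Iwaniec1978.siftedCount x 1 (x ^ (2 / u)) : ℝ) * Real.log x / x)
Filter.atTop (nhds (A * u * Literature.NumberTheory.Sieve.buchstabOmega u))) ∧ (∀ ε : ℝ, 0 < ε → ∃ δ
: ℝ, 0 < δ ∧ δ ≤ 1 / 4 ∧ ∀ᶠ x : ℝ in Filter.atTop,
(Literature.NumberTheory.Sieve.Iwaniec1978.siftedCount x 1 (x ^ (1 - δ)) : ℝ) ≤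
(Literature.NumberTheory.Sieve.nSqAddOnePrimeCount ⌊x⌋₊ : ℝ) + ε * x / Real.log x)`

## Assembly
Bookkeeping plus two proved tree facts. From RoughValueLaw take A; SieveCalibration (with u₀ = 3)
gives A·ω(u) → (𝔖/2)e^{−γ}, BuchstabLimit
gives A·ω(u) → A·e^{−γ}, so A = 𝔖/2 = `hardyLittlewoodEConst`/2 (limits in ℝ are unique, e^{−γ} ≠
0). Upper bound: a prime value n²+1 ≥ x^{2/u}
is coprime to P(x^{2/u}), so π_{n²+1}(N) ≤ Φ(N,u) + N^{1/u} + 1 for every u ∈ (2,3], whence limsup π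
log N/N ≤ (𝔖/2)·uω(u) =
(𝔖/2)(1 + log(u−1)) (`buchstabOmega_eq_of_mem_Icc_two_three`) → 𝔖/2 as u ↓ 2. Lower bound: given ε,
BalancedSemiprimeLayer supplies δ ≤ 1/4;
put u = 2/(1−δ) ∈ (2, 8/3]; then π_{n²+1}(⌊x⌋) ≥ Φ(x,u) − εx/log x eventually, so liminf π log N/N ≥
(𝔖/2)(1 + log(u−1)) − ε ≥ 𝔖/2 − ε.
Hence `nSqAddOnePrimeCount N ~ (𝔖/2) N/log N`, and `HardyLittlewoodConjE` follows with C =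
`hardyLittlewoodEConst` by
`tendsto_hardyLittlewoodE_partial_holds` (cf. `hardyLittlewoodConjE_iff_isEquivalent`).
WindowVsSignal is not used.

Rationale: WHY THIS LINE. Mechanism: transport of the Bateman–Horn constant along Buchstab's delay equation —
the sieve KNOWS the constant at infinite depth
(fundamental lemma: Φ(x,u) = xV(x^{2/u})(1 + O(e^{−u/2})), PROVED in the tree as
`SieveSequence.fundamental_lemma_uniform_holds`, with
V(z) log z → 𝔖e^{−γ} PROVED as `Iwaniec1978.tendsto_densityProd_mul_log` from
[IwaniecInventiones1978] §6 and Mertens), and the shape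
hypothesis X1 carries it down to u = 2, where X2 hands over to the primes; so HL-E's singular series
is OUTPUT, not input — any proof of
Buchstab shape with an unidentified constant already gives HL-E with the right one (the
e^γ-corrected sieve heuristic of
[Granville1995Irregularities]/doi:10.1080/03461238.1995.10413946 made into a typed conditional
theorem; integer prototype = Buchstab–de Bruijn,
PROVED in the tree as `exists_abs_card_roughIcc_sub_buchstab_le` after [Lichtman2025LinearSieve]
Lemma 6.1). Imported areas: (i) classical
sieve asymptotics (delay-differential equations: `buchstabOmega`, `hasDerivAt_mul_buchstabOmega` in
the tree); (ii) for X2, Type-I information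
BEYOND level x on the modulus side — equidistribution of roots of quadratic congruences /
Kloosterman sums on average (doi:10.1007/bf02395047
Hooley 1967, doi:10.5802/aif.891 and [DeshouillersIwaniec1982], doi:10.4171/jems/951 de la
Bretèche–Drappeau 2020, arXiv:1908.08816 Merikoski; Iwaniec's Proposition 1 is
PROVED in the tree as `Iwaniec1978.proposition1_holds`) and, through Lagrange's identity
(a²+b²)(c²+d²) = (ac−bd)² + (ad+bc)², the affine-sieve
upper bounds on SL₂(ℤ) of [BourgainGamburdSarnak2009] / doi:10.1007/s11511-010-0057-4 (Nevo–Sarnak):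
balanced semiprime values n²+1 = p₁p₂ are
unimodular matrices with two rows of prime norm in a skewed region, and X2 is an upper bound of the
right order there — the sieve-accessible
end of the balanced regime where routes UnimodularColumns (UnimodularMobius, D ≍ x) and CubicRoots
(CubicBalancedMobius) place their hardest
SIGNED atoms. What prior routes do not do: PolynomialMobius/QuadraticRoots/UnimodularColumns attack
a signed Möbius statement at one scale;
SelbergDelange deforms in z ∈ ℂ; this route deforms in the sieve depth u ∈ (2, ∞) with the constant
removed from the conjecture, and isolates the
u = 2 boundary layer as a separate, parity-free-looking crux. Negatives index: empty at filing.

RANKED CRUXES. #2 RoughValueLaw (crux) — Buchstab SHAPE of the rough values of n²+1 beyond the prime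
threshold, constant free: there is A ∈ ℝ such that for every u > 2, Φ(x,u)·log x/x → A·u·ω(u) as x →
∞, where Φ(x,u) = #{1 ≤ n ≤ x : p | n²+1 ⇒ p ≥ x^{2/u}} (card fixed-f-irregularity-parity-gated,
family B_f(U) for U > 2; card rough-values-buchstab-parity, RL(f,u) unsigned; expected A = 𝔖/2 = Γ
of Iwaniec). It asserts nothing about prime values (u ≤ 2 excluded) and no value of A. [difficulty:
open-problem] (why it might fail: HL-E-strength near u=2 (the rung u contains π_{n²+1}(x) as the
fraction 1/(1+log(u−1)) → 1 of Φ); at EVERY fixed u the law lies inside the linear-sieve window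
(WindowVsSignal + LinearSieveOptimality), so no Type-I input proves any rung; an f-specific bias of
rough values refutes it.) [Lichtman2025LinearSieve, Tenenbaum2015, IwaniecInventiones1978,
Granville1995Irregularities, FriedlanderGranville1991, GranvilleSoundararajan2007Uncertainty,
doi:10.1080/03461238.1995.10413946]
#3 BalancedSemiprimeLayer (crux) — the boundary layer at u = 2⁺ is thin: for every ε > 0 there is δ
∈ (0, 1/4] such that for all large x, #{1 ≤ n ≤ x : p | n²+1 ⇒ p ≥ x^{1−δ}} ≤ π_{n²+1}(⌊x⌋) + ε
x/log x. The excess counts exactly the BALANCED SEMIPRIME values n²+1 = p₁p₂, x^{1−δ} ≤ p₁ ≤ p₂ ≤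
x^{1+δ} (heuristically 2δ·(𝔖/2)·x/log x); via Lagrange/Gauss these are matrices (a,−b;c,d) ∈ SL₂(ℤ)
with both row norms prime, a²+b² ∈ [x^{1−δ}, x], 1 ≤ ac−bd ≤ x — an affine-sieve UPPER bound of the
right order in a skewed region, or equivalently an upper-bound sieve on the cofactor (n²+1)/p₁ fed
by equidistribution of roots of ν²+1 ≡ 0 modulo p₁q (Kloosterman sums on average). [difficulty: L]
(why it might fail: Needs roots of ν²+1 ≡ 0 mod p₁q equidistributed for PRIME p₁ ∈ [x^{1−δ}, x], q ≤
x^c — past Iwaniec's Prop 1 (M ≤ x^{1−3ε}), Type-II-like coefficient; n with such a p₁ number ≍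
x/log x ≍ π itself; thin set, no Type-II range (FordMaynardLowLevel); uniformity in δ may fail.)
[doi:10.1007/bf02395047, doi:10.5802/aif.891, DeshouillersIwaniec1982, doi:10.4171/jems/951,
arXiv:1908.08816, IwaniecInventiones1978, doi:10.1007/s11511-010-0057-4, BourgainGamburdSarnak2009,
LiuSarnak2010, DukeFriedlanderIwaniec1995, Toth2000]
#9 SieveCalibration (support) — the constant is fixed at infinite depth: for every A, if Φ(x,u)·log
x/x → A·u·ω(u) for all u ≥ u₀, then A·ω(u) → (𝔖/2)·e^{−γ} as u → ∞. Proof sketch (provable now):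
fundamental lemma for 𝒜 = {n²+1 : n ≤ x} with z = x^{2/u}, D = x^{1−ε} (tree:
`Literature.NumberTheory.Sieve.SieveSequence.fundamental_lemma_uniform_holds`; remainders |r_d| ≤
ρ(d), `Iwaniec1978.abs_rem_le_rho`; dimension-1 density by `Iwaniec1978.RhoMertensStrong_holds`)
gives Φ(x,u) = xV(z)(1 + O(e^{−(1−ε)u/2})) + o(x/log x), and V(z) log z → 𝔖e^{−γ} is
`Iwaniec1978.tendsto_densityProd_mul_log`; compare limits. [difficulty: provable-now] [Greaves2001,
IwaniecInventiones1978, Lichtman2025LinearSieve]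
#9 BuchstabLimit (support) — ω(u) → e^{−γ} as u → ∞ (de Bruijn 1950; Tenenbaum Ch. III.6; Harman
§1.4). Provable now, e.g. from the tree's integer Buchstab law
`exists_abs_card_roughIcc_sub_buchstab_le`, the fundamental lemma for the integers and Mertens'
third theorem `Literature.NumberTheory.LFunctions.Mertens.tendsto_log_mul_prod_one_sub_inv_nat`, or
analytically from the delay equation `hasDerivAt_mul_buchstabOmega`. Useful to every Maier-matrix
argument on the summit. [difficulty: provable-now] [Tenenbaum2015, Harman2007,
Lichtman2025LinearSieve, Maier1985]
#9 WindowVsSignal (support) — the card's lemma N1, typed (not in the Assembly chain; it records WHY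
RoughValueLaw at any fixed depth is outside Type-I reach): there are c > 0 and U₀ with |ω(U) −
e^{−γ}| ≤ e^{−cU log U}·(F₁ − f₁)(U/2) for U ≥ U₀, where F₁ = `BetaSieveForward.upper 1 2 1` =
F/(2e^γ), f₁ = `BetaSieveForward.lower 1 2 1` = f/(2e^γ) are the tree's linear-sieve functions (so ω
= F₁ + f₁ and F₁(s) − f₁(s) = ρ(s−1)/s, Dickman ρ; checked numerically at s = 3, 4). Depth U/2 is
what level x buys for n²+1 (values of size x²); the Maier signal |ω(U) − e^{−γ}| ≪ ρ(U−1)/U is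
smaller than the window ρ(U/2−1)/(U/2) by exp(−(½+o(1))U log U), so any c < 1/2 works. Real analysis
on two delay equations; provable now with effort. [difficulty: M] [Greaves2001, Tenenbaum2015,
IwaniecInventiones1978, Granville1995Irregularities, FriedlanderGranville1991]

TWO-LAYER PLAN. Foreseen glued split of BalancedSemiprimeLayer once a prover reports where Iwaniec's
Proposition 1 stops: BalancedSemiprimeLayer ⇐
LayerBelow (the semiprimes with p₁ ≤ x^{1−η}: upper-bound sieve on the cofactor with moduli p₁q,
level from `Iwaniec1978.proposition1_holds`)
→ LayerDiagonal (p₁ ∈ (x^{1−η}, x]: the genuinely balanced part, affine-sieve / Kloosterman input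
beyond Prop 1) → BalancedSemiprimeLayer
(glue: addition, η ↓ 0 bookkeeping). No split of RoughValueLaw is foreseen: no transfer principle
B(u+1) ⇒ B(u) exists (Buchstab's identity
along n²+1 brings in the descendant lines N(αt+β) in ℤ[i], cf. card hecke-orbit-antiaveraging), and
the card's N1 shows each fixed rung
is parity-gated.

KILL CRITERIA. RoughValueLaw REFUTED at any single depth u > 2 — a theorem or certified numerics
showing Φ(x,u)·log x/x converges to a limit ≠ (𝔖/2)uω(u)
(equivalently Φ/(e^γ ω(u) x V(x^{2/u})) ↛ 1), i.e. an f-specific bias of rough values of n²+1 —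
closes the route (`--reason
refuted:RoughValueLaw`) and is news for every BatemanHorn route (the random model fails along n²+1);
flag card rough-values-buchstab-parity.
BalancedSemiprimeLayer refuted (balanced semiprimes ≫ x/log x uniformly as δ → 0) contradicts the
HL-type prediction 2δ(𝔖/2)x/log x and would
itself be an anti-HL-E phenomenon: close and file the Ω-statement on the negative side.
SieveCalibration or BuchstabLimit refuted ⇒ a
normalisation slip in my statements (constant 𝔖/2, exponent 2/u, the factor u) ⇒ PIVOT: re-derive
and restate, do not close. HL-E proved
elsewhere (QuadraticRoots / UnimodularColumns / PolynomialMobius r2 / SelbergDelange) ⇒ close as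
superseded; RoughValueLaw then remains a
meaningful open statement (almost-prime laws at all depths) but no longer a route.

NOT DECOMPOSED YET. (i) Any attack on RoughValueLaw itself: the route is honest that no mechanism
for a fixed rung exists (card N1 = WindowVsSignal with
LinearSieveOptimality); candidate non-Type-I inputs (Möbius randomness of the z-smooth part of n²+1
on n with large smooth part; descendant
universality on average = Buchstab self-consistency of the profile) are layer-2 matters once
BalancedSemiprimeLayer and the supports land.
(ii) The card's negative theorem N2 — fixed-f Friedlander–Granville irregularity for the dilation
family {(qn+a)²+1} at scale (log height)^{u₀/2},
CONDITIONAL on RoughValueLaw at one u₀ with ω(u₀) ≠ e^{−γ} plus the Maier-matrix column input —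
belongs to the negative side
(a conditional addendum to Literature.Barriers.Parity.UniformBatemanHornBarrier, whose scope caveat
"nothing for any single polynomial" it
explains); not filed here. (iii) General f of degree d (z = x^{d/u}, constant C_f/d,
HardyLittlewoodConjE ↦ BatemanHornAsymptotic ![f]) and
k ≥ 2 (joint roughness, dimension-k Buchstab functions). (iv) Rates: uniformity in u, second-order
terms (the O(1/log z) drift seen numerically).

CHEAPEST FALSIFIER. Numerics of RoughValueLaw at u = 3, 4 (card N4 / rough-values-buchstab-parity
R5): compare Φ(x,u)·log x/x with (𝔖/2)uω(u) = 1.1622 (u = 3),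
1.5416 (u = 4), better in the drift-free normalisation Φ/(e^γ ω(u)·x·V(x^{2/u})) → 1. RUN THIS
SESSION (pure python, x = 10⁶, least prime factor
of n²+1 by root sieve, 0.8 s): ratios observed/predicted = 0.989, 0.981, 0.998, 0.994, 0.972, 0.910
at u = 2.2, 2.5, 3, 4, 6, 10 (the drift at
large u is the finite-z Mertens/secondary-term effect at z = x^{2/u} ≤ 100; at u = 3, 4 agreement to
0.2–0.6 %); π_{n²+1}(10⁶) = 54110 vs
𝔖·Σ 1/log(n²+1) = 53970. A refuter should push to x = 10⁹ with the V(z)-normalisation; a converged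
deviation > 1 % at u ∈ {3, 4} kills the line.
Second cheap check (lookup): whether de la Bretèche–Drappeau's level of distribution for n²+1
(doi:10.4171/jems/951) admits a PRIME modulus
factor p₁ ~ x^{1−o(1)} times q ≤ x^c; if only smooth/well-factorable moduli are covered,
BalancedSemiprimeLayer loses its named engine (demote
its Difficulty to open, keep the route).

NUMBERS. 𝔖 = hardyLittlewoodEConst = 1.3728134628…; 𝔖/2 = Γ (Iwaniec's `gamma`) = 0.6864067; e^{−γ}
= 0.5614594836; λ₀ = 𝔖e^{−γ} = 0.770779 (tree
`Iwaniec1978.lambda0`); ω(u) = 1/u on [1,2], (1 + log(u−1))/u on [2,3]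
(`buchstabOmega_eq_of_mem_Icc_two_three`), ω(3) = 0.56438, ω(4) = 0.56146…,
1/2 ≤ ω ≤ 1 (tree); uω(u) − 1 = log(u−1) on [2,3] = predicted (balanced semiprimes)/(primes) ratio
at z = x^{2/u}, → 2δ for z = x^{1−δ};
linear-sieve window F(s) − f(s) = 2e^γρ(s−1)/s: 0.3644 at s = 3, 0.0433 at s = 4 (checked against
F(4) = 1.0216, f(4) = 0.9783); Iwaniec 1978
Prop 1: Σ_{M<m<2M} B(x;m,N)² ≪ (1 + N^{7/2}M^{−5/4}x)x^{1+ε}, M < x (tree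
`Iwaniec1978.proposition1`), i.e. level MN ≈ x^{15/14} with M ≤ x^{1−3ε};
Hooley 1967: P⁺(n²+1) > n^{11/10} i.o.; Deshouillers–Iwaniec 1982 (doi:10.5802/aif.891): n^{1.202};
Merikoski (arXiv:1908.08816): n^{1.279}. Session numerics (x = 10⁶):
Φ(x,u) = 58087, 68487, 83923, 110920, 162611, 253847 at u = 2.2, 2.5, 3, 4, 6, 10; π_{n²+1}(10⁶) =
54110.

DEFINITION REQUESTS. None: every object exists in the tree
(`Literature.NumberTheory.Sieve.Iwaniec1978.siftedCount`, `…densityProd`, `…buchstabOmega`,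
`…BetaSieveForward.upper/lower`, `…nSqAddOnePrimeCount`, `…hardyLittlewoodEConst`,
`…HardyLittlewoodConjE`). No cite facts are needed
as hypotheses (the fundamental lemma, Mertens for ρ, Iwaniec's Proposition 1 and the integer
Buchstab law are PROVED tree theorems).

Novelty: Searches (2026-08-15): `lit search "polynomial values without small prime factors Buchstab
asymptotic sieve" --source all` (local 1: arXiv:math/9807102
Martin, smooth side; crossref 12: Wolke 1971 doi:10.4064/aa-19-4-327-333 and
Dartyge–Tenenbaum–Martin 2002 doi:10.1023/a:1015237700066 = SMOOTH values,
Friedlander–Iwaniec 1997 doi:10.1073/pnas.94.4.1054 parity-sensitive sieve; OpenAlex/S2/arXiv HTTP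
429); crossref title searches locating
doi:10.4171/jems/951 (de la Bretèche–Drappeau 2020), doi:10.1007/s11511-010-0057-4 (Nevo–Sarnak
2010), doi:10.1016/j.jnt.2018.04.013 (Horesh–Nevo
2018), doi:10.1007/bf02395047 (Hooley 1967); `lean search` over the tree (buchstabOmega,
RoughNumbersBuchstab, Iwaniec1978.*, fundamental_lemma_uniform,
MaierSieveOscillation, Barriers/Parity catalogue incl. the PROVED Maier1985_shortIntervals); all 6
BatemanHorn and 8 GHL route files; cards
fixed-f-irregularity-parity-gated, rough-values-buchstab-parity, maier-matrix-photograph,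
hecke-orbit-antiaveraging (their audited novelty
sections: Alladi 1982, de Bruijn 1950, MV Thm 7.11, NairPerelli1995, GS math/0406018); `ledger
negatives --problem Parity` (0).
Nearest prior art found: (a) the e^γ-corrected sieve heuristic for Hardy–Littlewood/Bateman–Horn
constants — Granville1995Irregularities and
doi:10.1080/03461238.1995.10413946 (Granville, "Harald Cramér and the distribution of prime
numbers"): the constant as lim (sieve density)×e^γω —
heuristic, never stated as "Buchstab shape with a free constant ⇒  [refs: 10.4064/aa-19-4-327-333, 10.1023/a:1015237700066, 10.1073/pnas.94.4.1054, 10.4171/jems/951, 10.1007/s11511-010-0057-4, 10.1016/j.jnt.2018.04.013, 10.1007/bf02395047, 10.1080/03461238.1995.10413946, math/9807102, 1908.08816, doi:10.4064/aa-19-4-327-333, doi:10.1023/a, doi:10.1073/pnas.94.4.1054, doi:10.4171/jems/951, doi:10.1007/s11511-010-0057-4, doi:10.1016/j.jnt.2018.04.013, doi:10.1007/bf023950]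

Barriers (technique_class: buchstab, fundamental-lemma, kloosterman, affine-sieve): - technique_class: buchstab, fundamental-lemma, kloosterman, affine-sieve
- Literature.Barriers.Parity.SelbergParityBarrier: APPLIES to RoughValueLaw at every fixed u and is
NOT evaded — reweighting n²+1 by 1 ± λ keeps all Type-I data and moves Φ(x,u) by the parity-split
Buchstab term (relative size |ρ′(u)|/(uω(u)) ≠ 0), so r2 is exactly where non-Type-I input must
enter; the route's content is the REDUCTION (constant and boundary layer are theorem-side), not an
evasion. It does not touch BalancedSemiprimeLayer (an upper bound of the right order, insensitive to
the reweighting at leading order).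
- Literature.Barriers.Parity.LinearSieveOptimality: APPLIES and is quantified by support
WindowVsSignal (window ρ(u/2−1)/(u/2) at the depth level x buys, signal ≪ ρ(u−1)/u): no
dimension-one sieve with Selberg-type remainders proves any rung of r2; used as the documented
reason, not evaded.
- Literature.Barriers.Parity.FordFixedLevelBarrier: consistent — level x^{1−ε} Type-I data are used
ONLY in SieveCalibration, to pin the constant at u = ∞ (where Ford's indeterminacy vanishes like
e^{−u/2}), never to produce primes.
- Literature.Barriers.Parity.FordMaynardLowLevel: APPLIES to any Type-I/II attack on r2 (values of
n²+1 are a thin set, c = 1/2, no Type-II range); for r3 the information is on the MODULUS side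
(roots of ν²+1 mod p₁q, positive density in the modulus), where (γ,θ,ν) = (1/2,0,1/3)-type inputs
exist (DukeFriedlanderIwaniec1995, Toth2000, doi:10.4171/jems/951) — partial eva

History (route lifecycle, newest last):
- 2026-08-15T13:49:20Z · CLOSED retired — not-a-thesis: assembly does not conclude the sub-problem Statement (operator:999:1257524)

sub-problem: BatemanHorn · status: closed(retired) · opened planner-plancard-Parity-BatemanHorn-fixed-f-i-8290ce11-0 2026-08-15T12:20:33Z · rev 0 · ledger route-Parity-BuchstabTransport
GENERATED by the gate from the ledger (D-0016/17). Provers cite these decls: `theorem foo : Summit.Parity.BatemanHorn.Theses.BuchstabTransport.<Decl> := …` in Summits/Parity/BatemanHorn/Theorems/<Name>.lean.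
-/

namespace Summit.Parity.BatemanHorn.Theses.BuchstabTransport

open scoped BigOperators Topology Manifold Classical MeasureTheory ProbabilityTheory Matrix InnerProductSpace ComplexConjugate ContinuousMap
open Filter Set Function TopologicalSpace MeasureTheory

attribute [summit_statement] _root_.BatemanHorn

/-- item stmt-Parity-7949 · crux · rank 2 · closed · moot by None · by planner
why it might fail: HL-E-strength near u=2 (the rung u contains π_{n²+1}(x) as the fraction 1/(1+log(u−1)) → 1 of Φ); at EVERY fixed u the law lies inside the linear-sieve window (WindowVsSignal + LinearSieveOptimality), so no Type-I input proves any rung; an f-specific bias of rough values refutes it.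
sources: Lichtman2025LinearSieve, Tenenbaum2015, IwaniecInventiones1978, Granville1995Irregularities, FriedlanderGranville1991, GranvilleSoundararajan2007Uncertainty
[crux] Buchstab SHAPE of the rough values of n²+1 beyond the prime threshold, constant free: there
is A ∈ ℝ such that for every u > 2, Φ(x,u)·log x/x → A·u·ω(u) as x → ∞, where Φ(x,u) = #{1 ≤ n ≤ x :
p | n²+1 ⇒ p ≥ x^{2/u}} (card fixed-f-irregularity-parity-gated, family B_f(U) for U > 2; card
rough-values-buchstab-parity, RL(f,u) unsigned; expected A = 𝔖/2 = Γ of Iwaniec). It asserts nothing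
about prime values (u ≤ 2 excluded) and no value of A. [difficulty: open-problem] -/
@[route_item "route-Parity-BuchstabTransport"]
def RoughValueLaw : Prop :=
  ∃ A : ℝ, ∀ u : ℝ, 2 < u → Filter.Tendsto (fun x : ℝ => (Literature.NumberTheory.Sieve.Iwaniec1978.siftedCount x 1 (x ^ (2 / u)) : ℝ) * Real.log x / x) Filter.atTop (nhds (A * u * Literature.NumberTheory.Sieve.buchstabOmega u))

/-- item stmt-Parity-7950 · crux · rank 3 · closed · moot by None · by planner
why it might fail: Needs roots of ν²+1 ≡ 0 mod p₁q equidistributed for PRIME p₁ ∈ [x^{1−δ}, x], q ≤ x^c — past Iwaniec's Prop 1 (M ≤ x^{1−3ε}), Type-II-like coefficient; n with such a p₁ number ≍ x/log x ≍ π itself; thin set, no Type-II range (FordMaynardLowLevel); uniformity in δ may fail.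
sources: doi:10.1007/bf02395047, doi:10.5802/aif.891, DeshouillersIwaniec1982, doi:10.4171/jems/951, arXiv:1908.08816, IwaniecInventiones1978
[crux] the boundary layer at u = 2⁺ is thin: for every ε > 0 there is δ ∈ (0, 1/4] such that for all
large x, #{1 ≤ n ≤ x : p | n²+1 ⇒ p ≥ x^{1−δ}} ≤ π_{n²+1}(⌊x⌋) + ε x/log x. The excess counts
exactly the BALANCED SEMIPRIME values n²+1 = p₁p₂, x^{1−δ} ≤ p₁ ≤ p₂ ≤ x^{1+δ} (heuristically
2δ·(𝔖/2)·x/log x); via Lagrange/Gauss these are matrices (a,−b;c,d) ∈ SL₂(ℤ) with both row norms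
prime, a²+b² ∈ [x^{1−δ}, x], 1 ≤ ac−bd ≤ x — an affine-sieve UPPER bound of the right order in a
skewed region, or equivalently an upper-bound sieve on the cofactor (n²+1)/p₁ fed by
equidistribution of roots of ν²+1 ≡ 0 modulo p₁q (Kloosterman sums on average). [difficulty: L] -/
@[route_item "route-Parity-BuchstabTransport"]
def BalancedSemiprimeLayer : Prop :=
  ∀ ε : ℝ, 0 < ε → ∃ δ : ℝ, 0 < δ ∧ δ ≤ 1 / 4 ∧ ∀ᶠ x : ℝ in Filter.atTop, (Literature.NumberTheory.Sieve.Iwaniec1978.siftedCount x 1 (x ^ (1 - δ)) : ℝ) ≤ (Literature.NumberTheory.Sieve.nSqAddOnePrimeCount ⌊x⌋₊ : ℝ) + ε * x / Real.log x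

/-- item stmt-Parity-7951 · support · rank 9 · closed · moot by None · by planner
sources: Greaves2001, IwaniecInventiones1978, Lichtman2025LinearSieve
[support] the constant is fixed at infinite depth: for every A, if Φ(x,u)·log x/x → A·u·ω(u) for all
u ≥ u₀, then A·ω(u) → (𝔖/2)·e^{−γ} as u → ∞. Proof sketch (provable now): fundamental lemma for 𝒜 =
{n²+1 : n ≤ x} with z = x^{2/u}, D = x^{1−ε} (tree:
`Literature.NumberTheory.Sieve.SieveSequence.fundamental_lemma_uniform_holds`; remainders |r_d| ≤
ρ(d), `Iwaniec1978.abs_rem_le_rho`; dimension-1 density by `Iwaniec1978.RhoMertensStrong_holds`)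
gives Φ(x,u) = xV(z)(1 + O(e^{−(1−ε)u/2})) + o(x/log x), and V(z) log z → 𝔖e^{−γ} is
`Iwaniec1978.tendsto_densityProd_mul_log`; compare limits. [difficulty: provable-now] -/
@[route_item "route-Parity-BuchstabTransport"]
def SieveCalibration : Prop :=
  ∀ A : ℝ, (∃ u₀ : ℝ, ∀ u : ℝ, u₀ ≤ u → Filter.Tendsto (fun x : ℝ => (Literature.NumberTheory.Sieve.Iwaniec1978.siftedCount x 1 (x ^ (2 / u)) : ℝ) * Real.log x / x) Filter.atTop (nhds (A * u * Literature.NumberTheory.Sieve.buchstabOmega u))) → Filter.Tendsto (fun u : ℝ => A * Literature.NumberTheory.Sieve.buchstabOmega u) Filter.atTop (nhds (Literature.NumberTheory.Sieve.hardyLittlewoodEConst / 2 * Real.exp (-Real.eulerMascheroniConstant)))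

/-- item stmt-Parity-7952 · support · rank 9 · closed · moot by None · by planner
sources: Tenenbaum2015, Harman2007, Lichtman2025LinearSieve, Maier1985
[support] ω(u) → e^{−γ} as u → ∞ (de Bruijn 1950; Tenenbaum Ch. III.6; Harman §1.4). Provable now,
e.g. from the tree's integer Buchstab law `exists_abs_card_roughIcc_sub_buchstab_le`, the
fundamental lemma for the integers and Mertens' third theorem
`Literature.NumberTheory.LFunctions.Mertens.tendsto_log_mul_prod_one_sub_inv_nat`, or analytically
from the delay equation `hasDerivAt_mul_buchstabOmega`. Useful to every Maier-matrix argument on the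
summit. [difficulty: provable-now] -/
@[route_item "route-Parity-BuchstabTransport"]
def BuchstabLimit : Prop :=
  Filter.Tendsto Literature.NumberTheory.Sieve.buchstabOmega Filter.atTop (nhds (Real.exp (-Real.eulerMascheroniConstant)))

/-- item stmt-Parity-7953 · support · rank 9 · closed · moot by None · by planner
sources: Greaves2001, Tenenbaum2015, IwaniecInventiones1978, Granville1995Irregularities, FriedlanderGranville1991
[support] the card's lemma N1, typed (not in the Assembly chain; it records WHY RoughValueLaw at any
fixed depth is outside Type-I reach): there are c > 0 and U₀ with |ω(U) − e^{−γ}| ≤ e^{−cU log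
U}·(F₁ − f₁)(U/2) for U ≥ U₀, where F₁ = `BetaSieveForward.upper 1 2 1` = F/(2e^γ), f₁ =
`BetaSieveForward.lower 1 2 1` = f/(2e^γ) are the tree's linear-sieve functions (so ω = F₁ + f₁ and
F₁(s) − f₁(s) = ρ(s−1)/s, Dickman ρ; checked numerically at s = 3, 4). Depth U/2 is what level x
buys for n²+1 (values of size x²); the Maier signal |ω(U) − e^{−γ}| ≪ ρ(U−1)/U is smaller than the
window ρ(U/2−1)/(U/2) by exp(−(½+o(1))U log U), so any c < 1/2 works. Real analysis on two delay
equations; provable now with effort. [difficulty: M] -/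
@[route_item "route-Parity-BuchstabTransport"]
def WindowVsSignal : Prop :=
  ∃ c : ℝ, 0 < c ∧ ∃ U₀ : ℝ, ∀ U : ℝ, U₀ ≤ U → |Literature.NumberTheory.Sieve.buchstabOmega U - Real.exp (-Real.eulerMascheroniConstant)| ≤ Real.exp (-(c * U * Real.log U)) * (Literature.NumberTheory.Sieve.BetaSieveForward.upper 1 2 1 (U / 2) - Literature.NumberTheory.Sieve.BetaSieveForward.lower 1 2 1 (U / 2))

/-- item stmt-Parity-7954 · assembly · rank 1 · closed · moot by None · by planner
sources: IwaniecInventiones1978, Lichtman2025LinearSieve, HardyLittlewood1923, BatemanHorn1962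
[assembly] RoughValueLaw → BalancedSemiprimeLayer → SieveCalibration → BuchstabLimit →
HardyLittlewoodConjE (the squeeze above; real x versus natural N via ⌊x⌋₊ = N on integers). -/
@[route_item "route-Parity-BuchstabTransport"]
def Assembly : Prop :=
  RoughValueLaw → BalancedSemiprimeLayer → SieveCalibration → BuchstabLimit → Literature.NumberTheory.Sieve.HardyLittlewoodConjE

end Summit.Parity.BatemanHorn.Theses.BuchstabTransport
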